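import Summits.BirchSwinnertonDyer.BirchSwinnertonDyer.Theorems.CountingDoorF2AtThreeRootNumberSieveTail
import Summits.BirchSwinnertonDyer.BirchSwinnertonDyer.Theorems.CountingDoorF2AtThreeSelmerAverageSieveTail
import Summits.BirchSwinnertonDyer.BirchSwinnertonDyer.Theorems.CountingDoorF2AtThreeCongruenceClassSplitting
import HarnessLib

/-!
# BirchSwinnertonDyer / CountingDoorF2AtThree — cruxes I2 `RootNumberPlusLowerDensityLargeF2`
# (stmt-BirchSwinnertonDyer-19441) and I1 `SelmerThreeAverageLargeF2` (-19440), lane «closed-form root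
# numbers + squarefree sieve»: both cruxes from inputs on SINGLE RESIDUE CLASSES `{a ≡ r (mod N)}`

Route `route-BirchSwinnertonDyer-CountingDoorF2AtThree` (cell bsd-rank2; TWIN leaf
`PAdicBSDRankTwoPositiveProportion`). The chain of the lane is now, modulo ONE printed theorem —
Bhargava–Ho's Thm. 9.1 for `F₂` WITH ITS EULER-PRODUCT CONSTANT (named fact `thm9_1_F2_eulerProduct`,
`Literature/…/BhargavaHo2022/LargeFamilyEulerProduct.lean`, whose proved corollary `.tail_estimate` is
the squarefree-sieve tail):

  input on every single class `F₂ ∩ {a ≡ r (mod N)}` in height boxes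
    ⇒ (`F2ClassSplitting.averageOnLE_of_classes`, fact-free) the input on every finitely-conditioned family
    ⇒ (`…SieveTail` files: tail estimate + lane A's sieve reductions) the input on every LARGE family
    = crux I1, resp. ⇒ crux I2 (`F2RootNumber.densityOnGE_rootNumber_of_averageOnLE`).

This file states the two end-to-end corollaries:
* `rootNumberPlusLowerDensityLargeF2_of_classBias` — **I2 ⟸** for some `θ < 2/3`, every subfamily
  `F₂ ∩ {a ≡ r (mod N)}` (a `CongruenceFamily₂` with finitely many conditions, each a single class or
  trivial, all nonempty) has `limsup_X avg (−w(E_a)) ≤ θ` — a `2/3`-BIAS bound for the root number in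
  arithmetic progressions of the parameter lattice, ordered by height (equidistribution: `θ = 0`);
* `selmerThreeAverageLargeF2_of_classAverage` — **I1 ⟸** `avg #Sel₃ ≤ 36` on every such class family.

HONEST STATUS: both inputs are OPEN — the first is weak Chowla for the irreducible quaternary
weight-12 discriminant form of `F₂` twisted by a Jacobi character (lane census GEN 0/2 and ideation
census r1 of crux I2), the second is Bhargava–Ho's orbit count for `(F₂, 3)` (crux I1); nothing here
proves I1 or I2. PARTITION: none — r_an ≥ 2, summit axis S0; TWIN (D-0056): n/a. B1 honesty: by-name
glue; the root number / Selmer group enter only as the averaged quantities; no analytic rank, no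
`L`-value; no S0 motion.

References: M. Bhargava, W. Ho, arXiv:2207.03309 (2022) §9.1 Thm. 9.1, Prop. 9.2, Thm. 9.6
[BhargavaHo2022]; H. Helfgott, arXiv:math/0408141 [Helfgott2004RootNumber].
-/

set_option linter.dupNamespace false

noncomputable section

open scoped Classical
open Filter Topology Finset
open Literature.NumberTheory.EllipticCurves.BhargavaHo2022
  Summit.BirchSwinnertonDyer.Rank2
  Summit.BirchSwinnertonDyer.BirchSwinnertonDyer.Theses.CountingDoorF2AtThree

namespace Summit.BirchSwinnertonDyer.BirchSwinnertonDyer.Theorems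

/-- **Crux I2 from a `2/3`-bias bound for the root number on single residue classes**, modulo ONLY
Bhargava–Ho's Thm. 9.1 with its constant. If for some `θ < 2/3` every subfamily of `F₂` with finitely
many congruence conditions, nonempty local conditions, EACH A SINGLE RESIDUE CLASS or trivial
(i.e. `F₂ ∩ {a ≡ r (mod N)}`), satisfies `limsup_X avg_{Ψ'(<X)} (−w(E_a)) ≤ θ`, then
`RootNumberPlusLowerDensityLargeF2`. Chain: classes ⇒ finitely-conditioned families
(`F2ClassSplitting.averageOnLE_of_classes`) ⇒ large families (`…_of_uniformBias`).
[cite: BhargavaHo2022, Thm. 9.1 (§9.1); Helfgott2004RootNumber, §1] -/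
theorem rootNumberPlusLowerDensityLargeF2_of_classBias (h : thm9_1_F2_eulerProduct)
    (hclass : ∃ θ : ℝ, θ < 2 / 3 ∧ ∀ Ψ' : CongruenceFamily₂,
      (∃ Y : ℕ, ∀ p : ℕ, Y ≤ p → Ψ'.residues p = Set.univ) →
      (∀ p : ℕ, p.Prime → (Ψ'.residues p).Nonempty) →
      (∀ p : ℕ, p.Prime → (Ψ'.residues p).Subsingleton ∨ Ψ'.residues p = Set.univ) →
      Ψ'.AverageOnLE (fun a ↦ -(a.curve.rootNumber : ℝ)) θ) :
    RootNumberPlusLowerDensityLargeF2 := by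
  obtain ⟨θ, hθ, hcl⟩ := hclass
  refine rootNumberPlusLowerDensityLargeF2_of_uniformBias h ⟨θ, hθ, fun Ψ hY hne ↦ ?_⟩
  exact F2ClassSplitting.averageOnLE_of_classes hcl Ψ hY hne fun Ψ' hY' hne' ↦
    eventually_card_below_pos_of_eulerProduct h Ψ' (isLarge_of_residues_eq_univ Ψ' hY'.choose_spec)
      hne'

/-- **Crux I2 from root-number equidistribution on single residue classes** (`θ = 0`): if on every
class family `F₂ ∩ {a ≡ r (mod N)}` (finitely many single-class conditions, all nonempty) the root
number has `limsup avg(−w) ≤ 0` — in particular if it equidistributes in every arithmetic progression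
of the parameter lattice ordered by height — then `RootNumberPlusLowerDensityLargeF2`, modulo the one
printed fact. OPEN (weak Chowla for `Δ_{F₂}`). [cite: Helfgott2004RootNumber, §1; BhargavaHo2022, Thm. 9.1] -/
theorem rootNumberPlusLowerDensityLargeF2_of_classEquidistribution (h : thm9_1_F2_eulerProduct)
    (hclass : ∀ Ψ' : CongruenceFamily₂,
      (∃ Y : ℕ, ∀ p : ℕ, Y ≤ p → Ψ'.residues p = Set.univ) →
      (∀ p : ℕ, p.Prime → (Ψ'.residues p).Nonempty) →
      (∀ p : ℕ, p.Prime → (Ψ'.residues p).Subsingleton ∨ Ψ'.residues p = Set.univ) →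
      Ψ'.AverageOnLE (fun a ↦ -(a.curve.rootNumber : ℝ)) 0) :
    RootNumberPlusLowerDensityLargeF2 :=
  rootNumberPlusLowerDensityLargeF2_of_classBias h ⟨0, by norm_num, hclass⟩

/-- **Crux I1 from `avg #Sel₃ ≤ 36` on single residue classes**, modulo ONLY Bhargava–Ho's Thm. 9.1
with its constant: if every subfamily `F₂ ∩ {a ≡ r (mod N)}` (finitely many single-class-or-trivial
conditions, all nonempty) satisfies `avg #Sel₃ ≤ 36` (`AverageOnLE`), then `SelmerThreeAverageLargeF2`
(a finitely-conditioned family with an empty local condition is empty and needs nothing).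
[cite: BhargavaHo2022, Thm. 9.1, Prop. 9.2, Thm. 9.6 (§9)] -/
theorem selmerThreeAverageLargeF2_of_classAverage (h : thm9_1_F2_eulerProduct)
    (hclass : ∀ Ψ' : CongruenceFamily₂,
      (∃ Y : ℕ, ∀ p : ℕ, Y ≤ p → Ψ'.residues p = Set.univ) →
      (∀ p : ℕ, p.Prime → (Ψ'.residues p).Nonempty) →
      (∀ p : ℕ, p.Prime → (Ψ'.residues p).Subsingleton ∨ Ψ'.residues p = Set.univ) →
      Ψ'.AverageOnLE (fun a ↦ (Nat.card (a.curve.selmerGroup 3) : ℝ)) 36) :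
    SelmerThreeAverageLargeF2 := by
  refine selmerThreeAverageLargeF2_of_finiteConditions' h fun Ψ hY ↦ ?_
  by_cases hne : ∀ p : ℕ, p.Prime → (Ψ.residues p).Nonempty
  · exact F2ClassSplitting.averageOnLE_of_classes hclass Ψ hY hne fun Ψ' hY' hne' ↦
      eventually_card_below_pos_of_eulerProduct h Ψ' (isLarge_of_residues_eq_univ Ψ' hY'.choose_spec)
        hne'
  · push Not at hne
    obtain ⟨p, hp, hempty⟩ := hne
    exact averageOnLE_of_residues_eq_empty Ψ hp hempty _ (by norm_num)

/-- **Modulo Bhargava–Ho's Thm. 9.1 with its constant, crux I1 is EQUIVALENT to `avg #Sel₃ ≤ 36` on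
every single residue class `F₂ ∩ {a ≡ r (mod N)}`** (with nonempty conditions); → is fact-free
(such families are large). [cite: BhargavaHo2022, Thm. 9.1, Prop. 9.2, Thm. 9.6 (§9)] -/
theorem selmerThreeAverageLargeF2_iff_classAverage (h : thm9_1_F2_eulerProduct) :
    SelmerThreeAverageLargeF2 ↔ ∀ Ψ' : CongruenceFamily₂,
      (∃ Y : ℕ, ∀ p : ℕ, Y ≤ p → Ψ'.residues p = Set.univ) →
      (∀ p : ℕ, p.Prime → (Ψ'.residues p).Nonempty) →
      (∀ p : ℕ, p.Prime → (Ψ'.residues p).Subsingleton ∨ Ψ'.residues p = Set.univ) →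
      Ψ'.AverageOnLE (fun a ↦ (Nat.card (a.curve.selmerGroup 3) : ℝ)) 36 :=
  ⟨fun hI1 Ψ' hY _ _ ↦ selmerThreeAverage_finiteConditions_of_largeF2 hI1 Ψ' hY,
    selmerThreeAverageLargeF2_of_classAverage h⟩

end Summit.BirchSwinnertonDyer.BirchSwinnertonDyer.Theorems

end
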